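/-
Copyright (c) 2026 the pub-hodgecm-mathlib formalisation cell (harness21).  Prover seat hodgecm-mathlib-A-p19 (g19), topic T5 = P8
«(C♯)hol interior», node Cc (3′) brick γ (desk F0P2-plan (g8) «=» 20:56:40Z: census-first, then statement-first head).  KERNEL: theorems only.
-/
import Literature.Analysis.SegalBargmann.FockInvariantLines
import HarnessLib

/-!
# A `U(σ)`-COVARIANT linear functional vanishes on every positive-degree summand `𝓟_k` of the Fock space (`|σ| > 1`)
# (Folland 1989, Ch. 4 §5, Prop. (4.76) read on functionals)

Topic `Analysis/SegalBargmann`; namespace `Literature.AnalysisSegalBargmann` → `Literature.Analysis.SegalBargmann`.  KERNEL ONLY: proved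
theorems; 0 definitions, 0 records, 0 `sorry`.  Companion of ★ `FockInvariantLines` (Folland Prop. (4.76): for `|σ| > 1` the only
`U(σ)`-stable line of `𝓕_σ` is the vacuum line `ℂ·ζ₀`, `unitaryStable_line_iff`).

THE STATEMENT.  Let `ℓ : 𝓕_σ → ℂ` be linear and COVARIANT on Folland's summand `𝓟_k = degSpan {k}` under the Fock action `ν₀ = fockRep` of `U(σ)`:
`ℓ(ν₀(U) w) = c(U) · ℓ(w)` for all `U ∈ U(σ)`, `w ∈ 𝓟_k`, with SOME scalar function `c`.  If `|σ| > 1` and `k ≠ 0`, then `ℓ` VANISHES on `𝓟_k`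
(`eq_zero_of_fockRep_covariant`).  Proof: `𝓟_k` is finite-dimensional with orthonormal basis `ζ_α e^{−(π/2)|z|²}` (`|α| = k`), so `ℓ|𝓟_k = ⟪G, ·⟫` for
the Riesz vector `G = Σ_{|α|=k} conj(ℓ ζ_α) ζ_α ∈ 𝓟_k`; covariance and unitarity give `ν₀(U⁻¹) G = conj(c U) · G` inside `𝓟_k` (`𝓟_k` is `ν₀`-stable,
★ `degSpan_invariant`), so the line of `G` is `U(σ)`-stable; by (4.76) `G ∈ ℂ·ζ₀ = 𝓟₀ ⟂ 𝓟_k` (★ `degSpan_zero_eq_span_vacuum`, ★ `degSpan_singleton_isOrtho`),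
hence `G = 0`.  Also recorded: the same with the covariance read through `U ↦ U⁻¹` and the degree-`0` complement (`ℓ` on `𝓟₀` is `ℓ(ζ₀)` times the
coefficient — bookkeeping only).

USE (pub-hodgecm cell, F0∕P2 node Cc (3′) of the (C♯)hol interior, `F0/P2/A-p19/g19/cc/ROAD-Cc-3prime.A-p19g19.md` step γ): the projected theta
functional `Θ_P` at a DEFINITE archimedean place is `U(V_w)`-invariant (FILE A ★ p831658 + theta equivariance) and, through the compact normal form
★ `IsArchWeilDatum.exists_vacChar` and the Bargmann transform, a covariant functional on each `𝓟_k`; this file kills every `k ≥ 1`, and `k = 0` is the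
Gaussian line handled by ★ p834388.  Mathlib has no Fock space ∕ Hermite functions (the tree's `SegalBargmann` topic supplies them).

## References
* [Folland1989] G. B. Folland, *Harmonic Analysis in Phase Space*, Princeton UP (1989), Ch. 4 §5, Prop. (4.76). [cite: Folland1989, Prop (4.76)]
-/

set_option autoImplicit false

noncomputable section

open Complex Matrix

open scoped ComplexConjugate InnerProductSpace

namespace Literature.Analysis.SegalBargmann

variable {σ : Type*} [Fintype σ] [DecidableEq σ]

/-- the Riesz vector of a linear functional on `𝓟_k` in the orthonormal basis `ζ_α`, `|α| = k`: `G = Σ conj(ℓ ζ_α) • ζ_α`. [folklore] -/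
private theorem inner_sum_conj_smul_fockBasis (k : ℕ) (ℓ : FockL2 σ →ₗ[ℂ] ℂ) {w : FockL2 σ} (hw : w ∈ degSpan (σ := σ) ({k} : Set ℕ)) :
    ⟪∑ α ∈ ((finite_setOf_mdeg_le (σ := σ) k).toFinset.filter fun α => mdeg α = k), conj (ℓ (fockBasis α)) • (fockBasis α : FockL2 σ), w⟫_ℂ = ℓ w := by
  -- both sides are linear in `w`; check on the spanning vectors `ζ_β`, `|β| = k`
  have key : ∀ β : σ →₀ ℕ, mdeg β = k →
      ⟪∑ α ∈ ((finite_setOf_mdeg_le (σ := σ) k).toFinset.filter fun α => mdeg α = k), conj (ℓ (fockBasis α)) • (fockBasis α : FockL2 σ), (fockBasis β : FockL2 σ)⟫_ℂ = ℓ (fockBasis β) := by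
    intro β hβ
    rw [sum_inner]
    have hβmem : β ∈ ((finite_setOf_mdeg_le (σ := σ) k).toFinset.filter fun α => mdeg α = k) := by
      rw [Finset.mem_filter, Set.Finite.mem_toFinset, Set.mem_setOf_eq]; exact ⟨hβ.le, hβ⟩
    rw [Finset.sum_eq_single_of_mem β hβmem]
    · refine (inner_smul_left (𝕜 := ℂ) (fockBasis β : FockL2 σ) (fockBasis β : FockL2 σ) _).trans ?_
      rw [starRingEnd_self_apply, orthonormal_iff_ite.mp fockBasis.orthonormal, if_pos rfl, mul_one]
    · intro α _ hαβ
      refine (inner_smul_left (𝕜 := ℂ) (fockBasis α : FockL2 σ) (fockBasis β : FockL2 σ) _).trans ?_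
      rw [orthonormal_iff_ite.mp fockBasis.orthonormal, if_neg hαβ, mul_zero]
  -- linearity in `w` over the span
  rw [degSpan] at hw
  refine Submodule.span_induction (p := fun w _ =>
      ⟪∑ α ∈ ((finite_setOf_mdeg_le (σ := σ) k).toFinset.filter fun α => mdeg α = k), conj (ℓ (fockBasis α)) • (fockBasis α : FockL2 σ), w⟫_ℂ = ℓ w) ?_ ?_ ?_ ?_ hw
  · rintro _ ⟨β, hβ, rfl⟩
    exact key β hβ
  · rw [inner_zero_right, map_zero]
  · intro x y _ _ hx hy
    rw [inner_add_right, map_add, hx, hy]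
  · intro a x _ hx
    rw [inner_smul_right, map_smul, smul_eq_mul, hx]

omit [DecidableEq σ] in
/-- the Riesz vector lies in `𝓟_k`. [folklore] -/
private theorem sum_conj_smul_fockBasis_mem (k : ℕ) (ℓ : FockL2 σ →ₗ[ℂ] ℂ) :
    (∑ α ∈ ((finite_setOf_mdeg_le (σ := σ) k).toFinset.filter fun α => mdeg α = k), conj (ℓ (fockBasis α)) • (fockBasis α : FockL2 σ)) ∈ degSpan (σ := σ) ({k} : Set ℕ) := by
  refine Submodule.sum_mem _ fun α hα => Submodule.smul_mem _ _ (Submodule.subset_span ⟨α, ?_, rfl⟩)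
  rw [Finset.mem_filter] at hα
  exact hα.2

omit [DecidableEq σ] in
/-- two vectors of `𝓟_k` with the same inner products against `𝓟_k` are equal. [folklore] -/
private theorem eq_of_inner_eq_on_degSpan {k : ℕ} {x y : FockL2 σ} (hx : x ∈ degSpan (σ := σ) ({k} : Set ℕ))
    (hy : y ∈ degSpan (σ := σ) ({k} : Set ℕ)) (h : ∀ w ∈ degSpan (σ := σ) ({k} : Set ℕ), ⟪x, w⟫_ℂ = ⟪y, w⟫_ℂ) : x = y := by
  have h1 : ⟪x - y, x - y⟫_ℂ = 0 := by
    rw [inner_sub_left, h _ (Submodule.sub_mem _ hx hy), sub_self]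
  exact sub_eq_zero.mp (inner_self_eq_zero.mp h1)

/-- **A `U(σ)`-COVARIANT LINEAR FUNCTIONAL VANISHES ON `𝓟_k`, `k ≠ 0`, when `|σ| > 1`.**  If `ℓ(ν₀(U) w) = c(U) · ℓ(w)` for all `U ∈ U(σ)` and all
`w ∈ 𝓟_k = degSpan {k}`, then `ℓ = 0` on `𝓟_k` — Folland's Prop. (4.76) («the single space `𝓟_0` when `n > 1`») applied to the Riesz vector of `ℓ|𝓟_k`.
[cite: Folland1989, Prop (4.76)] -/
theorem eq_zero_of_fockRep_covariant [Nontrivial σ] {k : ℕ} (hk : k ≠ 0) (ℓ : FockL2 σ →ₗ[ℂ] ℂ) (c : Matrix.unitaryGroup σ ℂ → ℂ)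
    (hℓ : ∀ (U : Matrix.unitaryGroup σ ℂ) (w : FockL2 σ), w ∈ degSpan (σ := σ) ({k} : Set ℕ) → ℓ (fockRep U w) = c U * ℓ w)
    {w : FockL2 σ} (hw : w ∈ degSpan (σ := σ) ({k} : Set ℕ)) : ℓ w = 0 := by
  set G : FockL2 σ := ∑ α ∈ ((finite_setOf_mdeg_le (σ := σ) k).toFinset.filter fun α => mdeg α = k), conj (ℓ (fockBasis α)) • (fockBasis α : FockL2 σ) with hGdef
  have hGmem : G ∈ degSpan (σ := σ) ({k} : Set ℕ) := sum_conj_smul_fockBasis_mem k ℓ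
  have hriesz : ∀ w ∈ degSpan (σ := σ) ({k} : Set ℕ), ⟪G, w⟫_ℂ = ℓ w := fun w hw => inner_sum_conj_smul_fockBasis k ℓ hw
  -- covariance + unitarity: `ν₀(U⁻¹) G = conj(c U) • G`
  have hcov : ∀ U : Matrix.unitaryGroup σ ℂ, fockRep U⁻¹ G = conj (c U) • G := by
    intro U
    refine eq_of_inner_eq_on_degSpan (degSpan_invariant _ U⁻¹ hGmem) (Submodule.smul_mem _ _ hGmem) fun w hw => ?_
    have h1 : ⟪fockRep U⁻¹ G, w⟫_ℂ = ⟪G, fockRep U w⟫_ℂ := by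
      rw [← LinearIsometryEquiv.inner_map_map (fockRep U) (fockRep U⁻¹ G) w, ← LinearIsometryEquiv.trans_apply,
        ← LinearIsometryEquiv.mul_def, ← map_mul, mul_inv_cancel, map_one]
      rfl
    rw [h1, hriesz _ (degSpan_invariant _ U hw), hℓ U w hw]
    exact ((inner_smul_left (𝕜 := ℂ) G w _).trans (by rw [starRingEnd_self_apply, hriesz w hw])).symm
  -- hence the line of `G` is `U(σ)`-stable
  have hstable : ∀ U : Matrix.unitaryGroup σ ℂ, fockRep U G ∈ ℂ ∙ G := fun U => by
    rw [← inv_inv U, hcov U⁻¹]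
    exact Submodule.smul_mem _ _ (Submodule.mem_span_singleton_self G)
  -- so `G = 0` (otherwise (4.76) puts it on the vacuum line `𝓟₀ ⟂ 𝓟_k`)
  have hG0 : G = 0 := by
    by_contra hne
    have hvac : G ∈ degSpan (σ := σ) ({0} : Set ℕ) := by
      rw [degSpan_zero_eq_span_vacuum]
      exact (unitaryStable_line_iff hne).mp hstable
    have horth := degSpan_singleton_isOrtho (σ := σ) (k := 0) (l := k) (Ne.symm hk)
    exact hne (inner_self_eq_zero.mp (horth.inner_eq hvac hGmem))
  rw [← hriesz w hw, hG0, inner_zero_left]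

/-- **Variant with the covariance read on `U⁻¹`** (the shape delivered by an INVARIANT functional `Θ ∘ ω(k) = Θ` once `ω(k)|_{𝓟_k}` is
`χ(k) ν₀(ι k)`: `ℓ ∘ ν₀(U) = χ(U)⁻¹ ℓ`). [cite: Folland1989, Prop (4.76)] -/
theorem eq_zero_of_fockRep_covariant' [Nontrivial σ] {k : ℕ} (hk : k ≠ 0) (ℓ : FockL2 σ →ₗ[ℂ] ℂ) (χ : Matrix.unitaryGroup σ ℂ → ℂ)
    (hℓ : ∀ (U : Matrix.unitaryGroup σ ℂ) (w : FockL2 σ), w ∈ degSpan (σ := σ) ({k} : Set ℕ) → χ U * ℓ (fockRep U w) = ℓ w)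
    (hχ : ∀ U, χ U ≠ 0) {w : FockL2 σ} (hw : w ∈ degSpan (σ := σ) ({k} : Set ℕ)) : ℓ w = 0 :=
  eq_zero_of_fockRep_covariant hk ℓ (fun U => (χ U)⁻¹) (fun U w hw => by
    rw [← hℓ U w hw, ← mul_assoc, inv_mul_cancel₀ (hχ U), one_mul]) hw

/-- **All positive degrees at once**: a functional covariant on every `𝓟_k` vanishes on `⊕_{k ≥ 1} 𝓟_k = degSpan {k | k ≠ 0}` — so on the
`U(σ)`-finite vectors it is `ℓ(ζ₀)` times the vacuum coefficient. [cite: Folland1989, Prop (4.76)] -/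
theorem eq_zero_of_fockRep_covariant_of_mem_degSpan_ne_zero [Nontrivial σ] (ℓ : FockL2 σ →ₗ[ℂ] ℂ) (c : ℕ → Matrix.unitaryGroup σ ℂ → ℂ)
    (hℓ : ∀ (k : ℕ) (U : Matrix.unitaryGroup σ ℂ) (w : FockL2 σ), w ∈ degSpan (σ := σ) ({k} : Set ℕ) → ℓ (fockRep U w) = c k U * ℓ w)
    {w : FockL2 σ} (hw : w ∈ degSpan (σ := σ) {k : ℕ | k ≠ 0}) : ℓ w = 0 := by
  rw [degSpan] at hw
  refine Submodule.span_induction (p := fun w _ => ℓ w = 0) ?_ (map_zero ℓ) (fun x y _ _ hx hy => by rw [map_add, hx, hy, add_zero])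
    (fun a x _ hx => by rw [map_smul, hx, smul_zero]) hw
  rintro _ ⟨α, hα, rfl⟩
  exact eq_zero_of_fockRep_covariant hα ℓ (c (mdeg α)) (hℓ (mdeg α)) (Submodule.subset_span ⟨α, rfl, rfl⟩)

end Literature.Analysis.SegalBargmann

end
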